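import Mathlib
import Summits.Ventures.DiscreteObjects.Mahler.EngineSoundness

/-!
# Soundness of the census pruning tests: odd degree (venture `DiscreteObjects`, target L)

Cell `pub-namedobj`, seat `pub-namedobj-mahler-g2`. Framing: lottery ticket; floor = certified bounds/negative
ranges.

Completes `EngineSoundness.lean` for odd `n = 2d+1` (used by the cell for the control row `n = 45`): the engines
enumerate the odd `rec` family (`a_j = a_{n-j}`, `P = (x+1)·R`), and the Graeffe iterates of an odd-degree
`rec` OR `anti` polynomial are odd-degree `anti` polynomials (`a_j = -a_{n-j}`, `P = (x-1)·R`, `R` rec of degree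
`2d`). We prove the structure lemma for odd `anti`, the tests T1/T2 for odd `anti`, the family tracking along
Graeffe chains, and the residual-free iterate theorems `rec_odd_coeff_test_iterate` /
`rec_odd_powerSum_test_iterate` (thresholds with `B^{2^m}`, `m ≥ 1`; `m = 0` is `rec_odd_*_test`).
-/

namespace Summit.Ventures.DiscreteObjects.Mahler

open Polynomial

/-- `reverse R = -R` ⇒ antipalindromic coefficients. -/
theorem antipalindromic_of_reverse_eq_neg {R : Type*} [CommRing R] (P : R[X]) (N : ℕ) (hdeg : P.natDegree = N)
    (hrev : P.reverse = -P) : ∀ j ≤ N, P.coeff j = -P.coeff (N - j) := by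
  intro j hj
  have h := congrArg (fun f => f.coeff (N - j)) hrev
  simp only [coeff_reverse, coeff_neg, hdeg] at h
  rw [revAt_le (Nat.sub_le N j), show N - (N - j) = j by omega] at h
  exact h

/-- `reverse (x - 1) = -(x - 1)`. -/
theorem reverse_X_sub_one {R : Type*} [CommRing R] [Nontrivial R] : (X - 1 : R[X]).reverse = -(X - 1) := by
  apply reverse_eq_neg_of_antipalindromic (X - 1 : R[X]) 1 (by compute_degree!)
  intro j hj
  interval_cases j <;> simp [coeff_X, coeff_one]

/-- **Odd-degree `anti` family.** A monic antipalindromic `P ∈ ℤ[x]` of degree `2d+1` is `(x-1)·R` with `R`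
monic palindromic of degree `2d`. -/
theorem odd_antipalindromic_decomposition (P : ℤ[X]) (d : ℕ) (hmonic : P.Monic)
    (hdeg : P.natDegree = 2 * d + 1) (hapal : ∀ j ≤ 2 * d + 1, P.coeff j = -P.coeff (2 * d + 1 - j)) :
    ∃ R : ℤ[X], P = (X - 1) * R ∧ R.Monic ∧ R.natDegree = 2 * d ∧
      ∀ j ≤ 2 * d, R.coeff j = R.coeff (2 * d - j) := by
  have hroot : P.IsRoot 1 := eval_one_eq_zero_of_antipalindromic P _ hdeg hapal
  set R := P /ₘ (X - C 1) with hR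
  have hX1 : (X - 1 : ℤ[X]) = X - C 1 := by simp
  have hPR : P = (X - 1) * R := by
    rw [hR, hX1]; exact ((mul_divByMonic_eq_iff_isRoot).mpr hroot).symm
  have hXm : (X - 1 : ℤ[X]).Monic := by rw [hX1]; exact monic_X_sub_C _
  have hRmonic : R.Monic := Monic.of_mul_monic_left hXm (hPR ▸ hmonic)
  have hRdeg : R.natDegree = 2 * d := by
    have h := congrArg natDegree hPR
    rw [hXm.natDegree_mul hRmonic, hdeg, show (X - 1 : ℤ[X]).natDegree = 1 by compute_degree!] at h
    omega
  have hRrev : R.reverse = R := by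
    have h1 : P.reverse = -P := reverse_eq_neg_of_antipalindromic P _ hdeg hapal
    rw [hPR, reverse_mul_of_domain, reverse_X_sub_one, neg_mul, neg_inj] at h1
    exact mul_left_cancel₀ hXm.ne_zero h1
  exact ⟨R, hPR, hRmonic, hRdeg, palindromic_of_reverse_eq_self R _ hRdeg hRrev⟩

/-- **T2, odd `anti` family (`n = 2d+1 ≥ 3`).** -/
theorem anti_odd_coeff_test (P : ℤ[X]) (d : ℕ) (hd : 1 ≤ d) (hmonic : P.Monic) (hdeg : P.natDegree = 2 * d + 1)
    (hapal : ∀ j ≤ 2 * d + 1, P.coeff j = -P.coeff (2 * d + 1 - j)) {B : ℝ} (hB : intMahlerMeasure P < B)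
    (i : ℕ) (hi1 : 1 ≤ i) (hi2 : i ≤ 2 * d) :
    (|P.coeff i| : ℝ) < ((X ^ 2 + C (B + B⁻¹) * X + 1 : ℝ[X]) * (X + 1) ^ (2 * d - 1)).coeff i := by
  obtain ⟨R, hPR, hRmonic, hRdeg, hRpal⟩ := odd_antipalindromic_decomposition P d hmonic hdeg hapal
  obtain ⟨s, hcard, hR⟩ := int_palindromic_factorisation R d hRmonic hRdeg hRpal
  have hs : s ≠ 0 := by intro h; rw [h, Multiset.card_zero] at hcard; omega
  have hMR : intMahlerMeasure R = intMahlerMeasure P := by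
    unfold intMahlerMeasure
    rw [hPR, Polynomial.map_mul, mahlerMeasure_mul,
      show ((X - 1 : ℤ[X]).map (Int.castRingHom ℂ)) = X - C 1 by simp, mahlerMeasure_X_sub_C]
    simp
  have hMR' : (R.map (Int.castRingHom ℂ)).mahlerMeasure = intMahlerMeasure P := hMR
  have hdomR := dominates_rec_product s hs
  rw [← hR, hcard, hMR'] at hdomR
  have hdom1 : Dominates (X + 1 : ℝ[X]) ((X - 1 : ℤ[X]).map (Int.castRingHom ℂ)) := by
    intro j
    rw [Polynomial.map_sub, Polynomial.map_one, map_X]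
    rcases j with _ | _ | j <;> simp [coeff_X, coeff_one]
  have hdom : Dominates ((X ^ 2 + C (intMahlerMeasure P + (intMahlerMeasure P)⁻¹) * X + 1 : ℝ[X]) *
      (X + 1) ^ (2 * d - 1)) (P.map (Int.castRingHom ℂ)) := by
    have h := hdom1.mul hdomR
    rw [← Polynomial.map_mul, ← hPR] at h
    have heq : (X + 1 : ℝ[X]) * ((X ^ 2 + C (intMahlerMeasure P + (intMahlerMeasure P)⁻¹) * X + 1) *
        (X + 1) ^ (2 * (d - 1))) = (X ^ 2 + C (intMahlerMeasure P + (intMahlerMeasure P)⁻¹) * X + 1) *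
        (X + 1) ^ (2 * d - 1) := by
      rw [show 2 * d - 1 = 2 * (d - 1) + 1 by omega, pow_succ]; ring
    rw [heq] at h
    exact h
  have hM1 := one_le_intMahlerMeasure_of_monic hmonic
  obtain ⟨j, rfl⟩ : ∃ j, i = j + 1 := ⟨i - 1, by omega⟩
  have h := strict_of_dominates _ (add_inv_lt_add_inv hM1 hB) _ (coeffNonneg_X_add_one_pow _) hdom j
    (coeff_X_add_one_pow_pos (by omega))
  rw [coeff_map] at h
  simpa [Complex.norm_intCast] using h

/-- **T1, odd `anti` family.** -/
theorem anti_odd_powerSum_test (P : ℤ[X]) (d : ℕ) (hd : 1 ≤ d) (hmonic : P.Monic)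
    (hdeg : P.natDegree = 2 * d + 1) (hapal : ∀ j ≤ 2 * d + 1, P.coeff j = -P.coeff (2 * d + 1 - j))
    {B : ℝ} (hB : intMahlerMeasure P < B) {k : ℕ} (hk : 0 < k) :
    ‖(((P.map (Int.castRingHom ℂ)).roots).map fun z => z ^ k).sum‖ < (2 * d - 1 : ℝ) + B ^ k + (B ^ k)⁻¹ := by
  obtain ⟨R, hPR, hRmonic, hRdeg, hRpal⟩ := odd_antipalindromic_decomposition P d hmonic hdeg hapal
  have hMR : intMahlerMeasure R = intMahlerMeasure P := by
    unfold intMahlerMeasure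
    rw [hPR, Polynomial.map_mul, mahlerMeasure_mul,
      show ((X - 1 : ℤ[X]).map (Int.castRingHom ℂ)) = X - C 1 by simp, mahlerMeasure_X_sub_C]
    simp
  have hRB : intMahlerMeasure R < B := by rw [hMR]; exact hB
  have hR := rec_even_powerSum_test R d hd hRmonic hRdeg hRpal hRB hk
  have hne : ((X - 1 : ℤ[X]) * R).map (Int.castRingHom ℂ) ≠ 0 :=
    Polynomial.map_monic_ne_zero (by rw [← hPR]; exact hmonic)
  rw [hPR, Polynomial.map_mul, roots_mul (by rw [← Polynomial.map_mul]; exact hne), Multiset.map_add,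
    Multiset.sum_add]
  have h1 : ((X - 1 : ℤ[X]).map (Int.castRingHom ℂ)).roots = {1} := by
    rw [Polynomial.map_sub, Polynomial.map_one, map_X, show (X - 1 : ℂ[X]) = X - C 1 by simp, roots_X_sub_C]
  rw [h1, Multiset.map_singleton, Multiset.sum_singleton, one_pow]
  calc ‖(1 : ℂ) + ((R.map (Int.castRingHom ℂ)).roots.map fun z => z ^ k).sum‖
      ≤ ‖(1 : ℂ)‖ + ‖((R.map (Int.castRingHom ℂ)).roots.map fun z => z ^ k).sum‖ := norm_add_le _ _
    _ = 1 + ‖((R.map (Int.castRingHom ℂ)).roots.map fun z => z ^ k).sum‖ := by simp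
    _ < 1 + ((2 * d - 2 : ℝ) + B ^ k + (B ^ k)⁻¹) := by linarith
    _ = _ := by ring

/-- A Graeffe iterate of an odd-degree `rec` or `anti` polynomial is an odd-degree `anti` polynomial. -/
theorem antipalindromic_of_isGraeffeIterate_odd (p q : ℤ[X]) (d : ℕ) (hdeg : p.natDegree = 2 * d + 1)
    (h : (∀ j ≤ 2 * d + 1, p.coeff j = p.coeff (2 * d + 1 - j)) ∨
      (∀ j ≤ 2 * d + 1, p.coeff j = -p.coeff (2 * d + 1 - j)))
    (hG : IsGraeffeIterate p q) : ∀ j ≤ 2 * d + 1, q.coeff j = -q.coeff (2 * d + 1 - j) := by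
  obtain ⟨_, hqdeg, hcomp⟩ := hG
  rw [hdeg] at hqdeg
  set pQ := p.map (Int.castRingHom ℚ) with hpQ
  set qQ := q.map (Int.castRingHom ℚ) with hqQ
  have hpQdeg : pQ.natDegree = 2 * d + 1 := by
    rw [hpQ, natDegree_map_eq_of_injective (Int.castRingHom ℚ).injective_int, hdeg]
  have hqQdeg : qQ.natDegree = 2 * d + 1 := by
    rw [hqQ, natDegree_map_eq_of_injective (Int.castRingHom ℚ).injective_int, hqdeg]
  -- functional equation of p with a sign ε = ±1: p(y) = ε y^N p(1/y)
  have hpfe : ∃ ε : ℚ, ε * ε = 1 ∧ ∀ y : ℚ, y ≠ 0 → pQ.eval y = ε * (y ^ (2 * d + 1) * pQ.eval y⁻¹) := by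
    rcases h with h | h
    · refine ⟨1, by norm_num, fun y hy => ?_⟩
      have hrev : pQ.reverse = pQ := reverse_eq_self_of_palindromic pQ _ hpQdeg
        (fun j hj => by rw [hpQ, coeff_map, coeff_map, h j hj])
      rw [eval_eq_reverse_eval_inv pQ hy, hrev, hpQdeg]; ring
    · refine ⟨-1, by norm_num, fun y hy => ?_⟩
      have hrev : pQ.reverse = -pQ := reverse_eq_neg_of_antipalindromic pQ _ hpQdeg
        (fun j hj => by rw [hpQ, coeff_map, coeff_map, h j hj]; simp)
      rw [eval_eq_reverse_eval_inv pQ hy, hrev, hpQdeg, eval_neg]; ring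
  obtain ⟨ε, hε, hfe⟩ := hpfe
  have hGe : (∀ y : ℚ, qQ.eval (y ^ 2) = pQ.eval y * pQ.eval (-y)) ∨
      (∀ y : ℚ, qQ.eval (y ^ 2) = -(pQ.eval y * pQ.eval (-y))) := by
    rcases hcomp with hc | hc
    · left; intro y
      have := congrArg (fun f : ℤ[X] => (f.map (Int.castRingHom ℚ)).eval y) hc
      simpa [hpQ, hqQ, map_comp, eval_comp] using this
    · right; intro y
      have := congrArg (fun f : ℤ[X] => (f.map (Int.castRingHom ℚ)).eval y) hc
      simpa [hpQ, hqQ, map_comp, eval_comp] using this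
  -- q(y²) = -(y²)^N q(1/y²)
  have hqfe : ∀ y : ℚ, y ≠ 0 → qQ.eval (y ^ 2) = -((y ^ 2) ^ (2 * d + 1) * qQ.eval (y ^ 2)⁻¹) := by
    intro y hy
    have e1 := hfe y hy
    have e2 := hfe (-y) (neg_ne_zero.mpr hy)
    rw [inv_neg, Odd.neg_pow (⟨d, rfl⟩ : Odd (2 * d + 1))] at e2
    have hsq : (y ^ 2)⁻¹ = y⁻¹ ^ 2 := by rw [inv_pow]
    rcases hGe with hc | hc
    · rw [hc y, e1, e2, hsq, hc y⁻¹]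
      linear_combination (-(y ^ (2 * d + 1) * pQ.eval y⁻¹ * (y ^ (2 * d + 1) * pQ.eval (-y⁻¹)))) * hε
    · rw [hc y, e1, e2, hsq, hc y⁻¹]
      linear_combination (y ^ (2 * d + 1) * pQ.eval y⁻¹ * (y ^ (2 * d + 1) * pQ.eval (-y⁻¹))) * hε
  have hagree : ∀ y : ℚ, y ≠ 0 → qQ.reverse.eval (y ^ 2) = (-qQ).eval (y ^ 2) := by
    intro y hy
    have hy2 : (y ^ 2)⁻¹ ≠ 0 := inv_ne_zero (pow_ne_zero 2 hy)
    have h1 := eval_eq_reverse_eval_inv qQ hy2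
    rw [inv_inv, hqQdeg] at h1
    have hne : (y ^ 2) ^ (2 * d + 1) ≠ 0 := pow_ne_zero _ (pow_ne_zero 2 hy)
    rw [eval_neg, hqfe y hy, h1, inv_pow]
    field_simp
  have hrev : qQ.reverse = -qQ := by
    apply Polynomial.eq_of_infinite_eval_eq
    have hsub : Set.range (fun n : ℕ => ((n : ℚ) + 1) ^ 2) ⊆ {x | eval x qQ.reverse = eval x (-qQ)} := by
      rintro _ ⟨n, rfl⟩
      exact hagree _ (by positivity)
    refine Set.Infinite.mono hsub (Set.infinite_range_of_injective ?_)
    intro a b hab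
    have hh := hab
    simp only at hh
    have ha : (0 : ℚ) ≤ (a : ℚ) + 1 := by positivity
    have hb : (0 : ℚ) ≤ (b : ℚ) + 1 := by positivity
    have := (pow_left_inj₀ ha hb two_ne_zero).mp hh
    exact_mod_cast (add_right_cancel this : (a : ℚ) = b)
  have hq := antipalindromic_of_reverse_eq_neg qQ (2 * d + 1) hqQdeg hrev
  intro j hj
  have hh := hq j hj
  rw [hqQ, coeff_map, coeff_map, ← map_neg] at hh
  exact (Int.castRingHom ℚ).injective_int hh

/-- Along a Graeffe chain of length `m+1` from an odd-degree `rec` polynomial: degree, `anti` shape, monic. -/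
theorem antipalindromic_of_graeffeChain_odd {P Q : ℤ[X]} {m : ℕ} (hG : GraeffeChain P (m + 1) Q) (d : ℕ)
    (hdeg : P.natDegree = 2 * d + 1) (hpal : ∀ j ≤ 2 * d + 1, P.coeff j = P.coeff (2 * d + 1 - j)) :
    Q.natDegree = 2 * d + 1 ∧ (∀ j ≤ 2 * d + 1, Q.coeff j = -Q.coeff (2 * d + 1 - j)) ∧ Q.Monic := by
  induction m generalizing Q with
  | zero =>
    cases hG with
    | step hc hqr =>
      cases hc with
      | refl =>
        exact ⟨hqr.2.1.trans hdeg, antipalindromic_of_isGraeffeIterate_odd _ _ d hdeg (Or.inl hpal) hqr, hqr.1⟩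
  | succ m ih =>
    cases hG with
    | step hc hqr =>
      obtain ⟨hdeg', hapal', _⟩ := ih hc
      exact ⟨hqr.2.1.trans hdeg', antipalindromic_of_isGraeffeIterate_odd _ _ d hdeg' (Or.inr hapal') hqr,
        hqr.1⟩

/-- **T2 on iterates (`m ≥ 1`), odd degree.** -/
theorem rec_odd_coeff_test_iterate (P Q : ℤ[X]) (m d : ℕ) (hd : 1 ≤ d) (hG : GraeffeChain P (m + 1) Q)
    (hdeg : P.natDegree = 2 * d + 1) (hpal : ∀ j ≤ 2 * d + 1, P.coeff j = P.coeff (2 * d + 1 - j))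
    {B : ℝ} (hB : intMahlerMeasure P < B) (i : ℕ) (hi1 : 1 ≤ i) (hi2 : i ≤ 2 * d) :
    (|Q.coeff i| : ℝ) <
      ((X ^ 2 + C (B ^ 2 ^ (m + 1) + (B ^ 2 ^ (m + 1))⁻¹) * X + 1 : ℝ[X]) * (X + 1) ^ (2 * d - 1)).coeff i := by
  obtain ⟨hQdeg, hQapal, hQmonic⟩ := antipalindromic_of_graeffeChain_odd hG d hdeg hpal
  exact anti_odd_coeff_test Q d hd hQmonic hQdeg hQapal (graeffe_bound hG hB) i hi1 hi2

/-- **T1 on iterates (`m ≥ 1`), odd degree.** -/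
theorem rec_odd_powerSum_test_iterate (P Q : ℤ[X]) (m d : ℕ) (hd : 1 ≤ d) (hG : GraeffeChain P (m + 1) Q)
    (hdeg : P.natDegree = 2 * d + 1) (hpal : ∀ j ≤ 2 * d + 1, P.coeff j = P.coeff (2 * d + 1 - j))
    {B : ℝ} (hB : intMahlerMeasure P < B) {k : ℕ} (hk : 0 < k) :
    ‖(((Q.map (Int.castRingHom ℂ)).roots).map fun z => z ^ k).sum‖ <
      (2 * d - 1 : ℝ) + (B ^ 2 ^ (m + 1)) ^ k + ((B ^ 2 ^ (m + 1)) ^ k)⁻¹ := by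
  obtain ⟨hQdeg, hQapal, hQmonic⟩ := antipalindromic_of_graeffeChain_odd hG d hdeg hpal
  exact anti_odd_powerSum_test Q d hd hQmonic hQdeg hQapal (graeffe_bound hG hB) hk

end Summit.Ventures.DiscreteObjects.Mahler
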